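import Summits.QuantumFields.YangMills.Theorems.BalabanUVNodesN15KingModelHeatKernelFullPropagatorWoodbury
import Summits.QuantumFields.YangMills.Theorems.BalabanUVNodesN15KingModelFullPropagatorProfile
import HarnessLib

/-!
# BalabanUVNodes ∕ N15 — THE KING-MODEL RUNG (PART Ϻ-b): BLOCK GEOMETRY FOR THE INVERSE-SQUARE LAW — fine-torus versus block-torus distances BOTH ways
# (`N·dist_M(b,b′) − (N−1) ≤ dist_fine(x,x′) ≤ N·dist_M(b,b′) + (N−1)` for `x ∈ B(b)`, `x′ ∈ B(b′)`), the THREE-LEG SPLIT, the volume-uniform exponential row sums of King's `Δ_eff`,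
# and the three numeric conversions (near zone `1∕N² ≤ 50∕(1+dist²)`; far legs `1∕(1+dist_leg²) ≤ 49∕(1+dist²)`; far tail `e^{−κD∕3}∕N² ≤ (50∕κ²)∕(1+dist²)`)
# (Track A, DAG node N15 = NE2; FAN-OUT v1.1 §N15 s3 «KING-MODEL RUNG … + what the curved case adds»; count-neutral)

HONEST FRAMING.  Count-neutral (cell `pub-ymgap`, seat `pub-ymgap-dag-n15-e` g56; `--supports stmt-QuantumFields-27247 --as helper` = K3ᴬ).  Elementary geometry of King's two-level torus
`Tor (fine N M) → Tor M` ([King1986] §2.1 p.652, blocks `B(b) = {N·b + j}`; the sup-norm torus distance `tdistT` of the tree, [Balaban1983RegularityDecay] §5) — the bookkeeping by which PART Ϻ-c∕d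
turn PART Ϣ's fine-lattice power law `L²|G(u,x)| ≤ C₀∕(1+dist_fine(u,x)²)` and King's block-lattice decay `|Δ_eff(b,b′)| ≤ C_Δe^{−κ_A·dist_M(b,b′)}` into ONE inverse-square law for the full propagator.
* §1 the upper direction `dist_fine(u,v) ≤ N·dist_M(β_u,β_v) + (N−1)` (`β_u = blockOf u`) IS the tree's R-a `N15KingModelRung.Curved.tdistT_fine_le_blocks` ∕ `tdistT_site_le_blocks` (cited, not restated;
  the preflight's `dedup.landed` found it); NEW here: ★★ **`mul_tdistT_blockOf_le`** (`N·dist_M(β_u,b) ≤ dist_fine(u,x_j) + (N−1)` for `x_j ∈ B(b)`; the tree's `mul_tdistT_blocks_le` at `u = site β_u j_u`);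
* §2 ★ `exists_leg_ge_third` (the three-leg split: `dist(β,β′) ≤ dist(β,b) + dist(b,b′) + dist(b′,β′)`, so one leg is `≥ dist(β,β′)∕3`);
* §3 ★ `sum_exp_neg_mul_tdistT_le`∕`…_le'` (`Σ_be^{−κ·dist_M(b,b′)} ≤ latticeConst (d+1) κ`, both slots — the tree's `tdistT_sumBound`, volume-free), ★★ **`sum_abs_effLaplacian_le`**∕`…_le'` (`Σ_b|Δ_eff(b,b′)| ≤
  C_Δ(a,d+1)·latticeConst (d+1) (κ_A(a,d+1))` at `c = N²` (tori `Π_{μ<d+1}ℤ∕M_μ`), every `N`, every torus — King's (4.34)(ii) `effLaplacian_decay` summed);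
* §4 the numeric conversions (pure real inequalities, `N ≥ 1`): ★ `exp_neg_le_four_div_sq` (`e^{−x} ≤ 4∕x²`, `x > 0`), ★ `inv_sq_le_near` (`dist ≤ ND + N − 1`, `D < 6` ⟹ `1∕N² ≤ 50∕(1+dist²)`), ★ `one_div_leg_le_far`
  (`D ≥ 6`, `ℓ ≥ D∕3`, `dist_leg ≥ Nℓ − (N−1)`, `dist ≤ ND + N − 1` ⟹ `1∕(1+dist_leg²) ≤ 49∕(1+dist²)`), ★ `exp_tail_le_far` (`D ≥ 6`, `dist ≤ ND + N − 1` ⟹ `e^{−κD∕3}∕N² ≤ (50∕κ²)∕(1+dist²)`).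
HONEST SCOPE: geometry and arithmetic only; the crude constants `49`, `50` come from `D+1 ≤ 7D∕6` and `D∕3 − 1 ≥ D∕6` at `D ≥ 6`; NOT a node discharge; nothing continuum ∕ Clay.
PRIOR TREE ART (by name): R-a `Curved.tdistT_fine_le_blocks`, `Curved.tdistT_site_le_blocks`, `Curved.circAbs_mul_add_le` (`…FullPropagatorProfile`); King1986.Torus `tdistT`, `site`, `blockOf`, `exists_eq_site`,
`mul_tdistT_blocks_le`, `tdistT_triangle`, `tdistT_symm`, `tdistT_nonneg`, `tdistT_sumBound`, `effLaplacian_decay`, `CDelta`, `kapA`; B4Sect5Proof `latticeConst`.  Dedup (rg at filing): basename 0 files; needles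
`mul_tdistT_blockOf_le|exists_leg_ge_third|sum_abs_effLaplacian_le|exp_neg_le_four_div_sq|inv_sq_le_near|one_div_leg_le_far|exp_tail_le_far` 0 tree files; preflight v1 `dedup.landed` ×1 (`tdistT_fine_le_blocks` ≡ R-a's) —
deleted, cited.  presearch: n/a (elementary).  Locators: [King1986] (2.1)–(2.4) p.652, (4.34) p.674; [Balaban1983RegularityDecay] §5 p.600 (lattice sums `Σe^{−a|x|}`); [Dimock2013] App. D Lemma 30.
0 `sorry`, 0 `def`.
-/

noncomputable section

open Real Finset
open scoped BigOperators

namespace Summit.QuantumFields.YangMills.BalabanUVNodes.N15KingModelRung.HeatKernel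

open Literature.MathematicalPhysics.QuantumFieldTheory.Balaban1983to89.B5Prop11Plancherel (Tor fine)
open Literature.MathematicalPhysics.QuantumFieldTheory.Balaban1983to89 (B4Sect5Proof.latticeConst)
open Literature.MathematicalPhysics.QuantumFieldTheory.King1986.Torus
  (effLaplacian site blockOf exists_eq_site mul_tdistT_blocks_le tdistT tdistT_nonneg tdistT_triangle tdistT_symm tdistT_sumBound effLaplacian_decay CDelta kapA kapA_pos CDelta_pos)

/-! ## §1 Fine versus block distances, both ways -/

variable {d : ℕ} (N : ℕ) [NeZero N] (M : Fin (d + 1) → ℕ) [hM : ∀ μ, NeZero (M μ)]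

/-- ★★ **DISTANT BLOCKS ARE DISTANT FROM EVERY FINE POINT**: `N·dist_M(β_u, b) ≤ dist_fine(u, x_j) + (N−1)` for `x_j ∈ B(b)` (the tree's `mul_tdistT_blocks_le` at `u = site β_u j_u`).
[cite: King1986, (2.1)–(2.4) p.652] -/
theorem mul_tdistT_blockOf_le (u : Tor (fine N M)) (b : Tor M) (j : Fin (d + 1) → Fin N) :
    (N : ℝ) * tdistT M (blockOf N M u) b ≤ tdistT (fine N M) u (site N M b j) + ((N : ℝ) - 1) := by
  obtain ⟨ju, hju⟩ := exists_eq_site N M u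
  have h := mul_tdistT_blocks_le N M (blockOf N M u) b ju j
  rw [← hju] at h
  exact h

/-! ## §2 The three-leg split -/

omit hM in
/-- ★ THE THREE-LEG SPLIT: for any four blocks, `dist(β,β′) ≤ dist(β,b) + dist(b,b′) + dist(b′,β′)`, hence ONE of the three legs is at least `dist(β,β′)∕3`. [folklore] -/
theorem exists_leg_ge_third [∀ μ, NeZero (M μ)] (β β' b b' : Tor M) :
    tdistT M β β' / 3 ≤ tdistT M β b ∨ tdistT M β β' / 3 ≤ tdistT M b b' ∨ tdistT M β β' / 3 ≤ tdistT M b' β' := by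
  have h1 := tdistT_triangle M β b β'
  have h2 := tdistT_triangle M b b' β'
  by_contra h
  simp only [not_or, not_le] at h
  obtain ⟨ha, hb, hc⟩ := h
  linarith

/-! ## §3 Volume-uniform exponential row sums of the effective Laplacian -/

/-- ★ `Σ_b e^{−κ·dist_M(b′,b)} ≤ latticeConst (d+1) κ` for every `κ > 0`, every centre `b′`, EVERY torus (the tree's `tdistT_sumBound`). [cite: Balaban1983RegularityDecay, §5 p.600] -/
theorem sum_exp_neg_mul_tdistT_le {κ : ℝ} (hκ : 0 < κ) (b' : Tor M) :
    ∑ b, Real.exp (-(κ * tdistT M b' b)) ≤ B4Sect5Proof.latticeConst (d + 1) κ :=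
  tdistT_sumBound M κ hκ b'

/-- ★ … the same with the summation variable in the first slot (`tdistT` is symmetric). [cite: Balaban1983RegularityDecay, §5 p.600] -/
theorem sum_exp_neg_mul_tdistT_le' {κ : ℝ} (hκ : 0 < κ) (b' : Tor M) :
    ∑ b, Real.exp (-(κ * tdistT M b b')) ≤ B4Sect5Proof.latticeConst (d + 1) κ := by
  have e : ∀ b, tdistT M b b' = tdistT M b' b := fun b => tdistT_symm M b b'
  simp only [e]
  exact sum_exp_neg_mul_tdistT_le M hκ b'

/-- ★★ **THE ROW SUMS OF KING's EFFECTIVE LAPLACIAN, UNIFORMLY IN THE VOLUME**: at `c = N²`, `Σ_b|Δ_eff(b,b′)| ≤ C_Δ(a,d+1)·latticeConst (d+1) (κ_A(a,d+1))` for every `b′`, every `N ≥ 1`, every torus (King's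
(4.34)(ii) `effLaplacian_decay` summed by `tdistT_sumBound`). [cite: King1986, (4.34) p.674; Dimock2013, App. D Lemma 30; Balaban1983RegularityDecay, §5 p.600] -/
theorem sum_abs_effLaplacian_le {a m2 : ℝ} (ha : 0 < a) (hm : 0 < m2) (b' : Tor M) :
    ∑ b, |effLaplacian N M a ((N : ℝ) ^ 2) m2 b b'| ≤ CDelta a (d + 1) * B4Sect5Proof.latticeConst (d + 1) (kapA a (d + 1)) := by
  calc ∑ b, |effLaplacian N M a ((N : ℝ) ^ 2) m2 b b'|
      ≤ ∑ b, CDelta a (d + 1) * Real.exp (-(kapA a (d + 1) * tdistT M b b')) := Finset.sum_le_sum fun b _ => effLaplacian_decay N M ha hm b b'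
    _ = CDelta a (d + 1) * ∑ b, Real.exp (-(kapA a (d + 1) * tdistT M b b')) := by rw [Finset.mul_sum]
    _ ≤ CDelta a (d + 1) * B4Sect5Proof.latticeConst (d + 1) (kapA a (d + 1)) :=
        mul_le_mul_of_nonneg_left (sum_exp_neg_mul_tdistT_le' M (kapA_pos ha (d + 1)) b') (CDelta_pos ha (d + 1)).le

/-- ★★ … and the column sums: `Σ_{b′}|Δ_eff(b,b′)| ≤ C_Δ(a,d+1)·latticeConst (d+1) (κ_A(a,d+1))`. [cite: King1986, (4.34) p.674; Dimock2013, App. D Lemma 30] -/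
theorem sum_abs_effLaplacian_le' {a m2 : ℝ} (ha : 0 < a) (hm : 0 < m2) (b : Tor M) :
    ∑ b', |effLaplacian N M a ((N : ℝ) ^ 2) m2 b b'| ≤ CDelta a (d + 1) * B4Sect5Proof.latticeConst (d + 1) (kapA a (d + 1)) := by
  calc ∑ b', |effLaplacian N M a ((N : ℝ) ^ 2) m2 b b'|
      ≤ ∑ b', CDelta a (d + 1) * Real.exp (-(kapA a (d + 1) * tdistT M b b')) := Finset.sum_le_sum fun b' _ => effLaplacian_decay N M ha hm b b'
    _ = CDelta a (d + 1) * ∑ b', Real.exp (-(kapA a (d + 1) * tdistT M b b')) := by rw [Finset.mul_sum]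
    _ ≤ CDelta a (d + 1) * B4Sect5Proof.latticeConst (d + 1) (kapA a (d + 1)) :=
        mul_le_mul_of_nonneg_left (sum_exp_neg_mul_tdistT_le M (kapA_pos ha (d + 1)) b) (CDelta_pos ha (d + 1)).le

/-! ## §4 The numeric conversions -/

/-- ★ `e^{−x} ≤ 4∕x²` for `x > 0` (from `1 + x∕2 ≤ e^{x∕2}`, squared). [folklore] -/
theorem exp_neg_le_four_div_sq {x : ℝ} (hx : 0 < x) : Real.exp (-x) ≤ 4 / x ^ 2 := by
  have h1 : x / 2 + 1 ≤ Real.exp (x / 2) := Real.add_one_le_exp (x / 2)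
  have h2 : (x / 2) ^ 2 ≤ Real.exp x := by
    have h3 : (x / 2) ^ 2 ≤ (x / 2 + 1) ^ 2 := by nlinarith
    have h4 : (x / 2 + 1) ^ 2 ≤ Real.exp (x / 2) ^ 2 := pow_le_pow_left₀ (by positivity) h1 2
    have h5 : Real.exp (x / 2) ^ 2 = Real.exp x := by rw [← Real.exp_nat_mul]; congr 1; ring
    linarith [h5 ▸ h4]
  rw [Real.exp_neg, inv_eq_one_div, div_le_div_iff₀ (Real.exp_pos x) (by positivity)]
  nlinarith

/-- ★ NEAR ZONE: if `dist ≤ N·D + (N−1)` with `D < 6` and `N ≥ 1` then `1∕N² ≤ 50∕(1 + dist²)` (`dist < 7N`). [folklore] -/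
theorem inv_sq_le_near {Nr D t : ℝ} (hN : 1 ≤ Nr) (hD : D < 6) (ht0 : 0 ≤ t) (ht : t ≤ Nr * D + (Nr - 1)) :
    1 / Nr ^ 2 ≤ 50 / (1 + t ^ 2) := by
  have h1 : t ≤ 7 * Nr := by nlinarith
  have h2 : 1 + t ^ 2 ≤ 50 * Nr ^ 2 := by nlinarith
  rw [div_le_div_iff₀ (by positivity) (by positivity)]
  linarith

/-- ★ FAR LEGS: if `D ≥ 6`, `ℓ ≥ D∕3`, `dist_leg ≥ N·ℓ − (N−1)` and `dist ≤ N·D + (N−1)` (`N ≥ 1`) then `1∕(1 + dist_leg²) ≤ 49∕(1 + dist²)` (`dist_leg ≥ ND∕6`, `dist ≤ 7ND∕6`). [folklore] -/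
theorem one_div_leg_le_far {Nr D ℓ s t : ℝ} (hN : 1 ≤ Nr) (hD : 6 ≤ D) (hℓ : D / 3 ≤ ℓ) (hs : Nr * ℓ - (Nr - 1) ≤ s) (ht0 : 0 ≤ t) (ht : t ≤ Nr * D + (Nr - 1)) :
    1 / (1 + s ^ 2) ≤ 49 / (1 + t ^ 2) := by
  have hND : 6 ≤ Nr * D := by nlinarith
  have h1 : Nr * D / 6 ≤ s := by nlinarith
  have h2 : t ≤ 7 * (Nr * D) / 6 := by nlinarith
  have h3 : 0 ≤ Nr * D / 6 := by positivity
  have h4 : (Nr * D / 6) ^ 2 ≤ s ^ 2 := pow_le_pow_left₀ h3 h1 2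
  have h5 : t ^ 2 ≤ (7 * (Nr * D) / 6) ^ 2 := pow_le_pow_left₀ ht0 h2 2
  rw [div_le_div_iff₀ (by positivity) (by positivity)]
  nlinarith

/-- ★ FAR TAIL: if `D ≥ 6`, `dist ≤ N·D + (N−1)` (`N ≥ 1`) and `κ > 0` then `e^{−κD∕3}∕N² ≤ (50∕κ²)∕(1 + dist²)` (`e^{−κD∕3} ≤ 36∕(κ²D²)`, `1 + dist² ≤ (50∕36)N²D²`). [folklore] -/
theorem exp_tail_le_far {Nr D t κ : ℝ} (hN : 1 ≤ Nr) (hD : 6 ≤ D) (ht0 : 0 ≤ t) (ht : t ≤ Nr * D + (Nr - 1)) (hκ : 0 < κ) :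
    Real.exp (-(κ * (D / 3))) / Nr ^ 2 ≤ (50 / κ ^ 2) / (1 + t ^ 2) := by
  have hx : 0 < κ * (D / 3) := by positivity
  have h1 : Real.exp (-(κ * (D / 3))) ≤ 4 / (κ * (D / 3)) ^ 2 := exp_neg_le_four_div_sq hx
  have hND : 6 ≤ Nr * D := by nlinarith
  have h2 : t ≤ 7 * (Nr * D) / 6 := by nlinarith
  have h5 : t ^ 2 ≤ (7 * (Nr * D) / 6) ^ 2 := pow_le_pow_left₀ ht0 h2 2
  have h6 : 1 + t ^ 2 ≤ (50 / 36) * (Nr * D) ^ 2 := by nlinarith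
  have hN2 : 0 < Nr ^ 2 := by positivity
  calc Real.exp (-(κ * (D / 3))) / Nr ^ 2 ≤ (4 / (κ * (D / 3)) ^ 2) / Nr ^ 2 := div_le_div_of_nonneg_right h1 hN2.le
    _ = 36 / (κ ^ 2 * (Nr * D) ^ 2) := by field_simp; ring
    _ ≤ (50 / κ ^ 2) / (1 + t ^ 2) := by
        rw [div_le_div_iff₀ (by positivity) (by positivity)]
        have hκ2 : 0 < κ ^ 2 := by positivity
        have e : 50 / κ ^ 2 * (κ ^ 2 * (Nr * D) ^ 2) = 50 * (Nr * D) ^ 2 := by field_simp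
        rw [e]
        nlinarith

end Summit.QuantumFields.YangMills.BalabanUVNodes.N15KingModelRung.HeatKernel

end
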